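import Literature.Probability.LatticeModels.KCSignConditionScaleFlat
import Literature.Probability.LatticeModels.LatticeWalkTrace
import HarnessLib

/-!
# The sign-condition argument at one mesh: seed, ends, confinement, and the inequality

Topic `Literature/Probability/LatticeModels`. Conclusion of the one-mesh verification begun in
`KCSignConditionScale.lean` (`…Chain`, `…Flat`): the seed data (a frozen bond near the seed
plaquette, the seed boxes `ρ ≈ 101 κ/δ`, `R ≈ Θ_R κ/δ` and the indicator `gV`), the packaging of
the two ends (`haE`, `hLE`, `hdeadE`, `hrunE`, `hconeE`, `hcarry`), the confinement of the region
`D` away from the exceptional bulk region `W` by the winding certificate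
(`not_mem_touchReach_of_certificate`), and finally **`one_mesh_ineq`**: the lattice inequality
`kc_sign_condition_ineq'` evaluated on the configuration, in the scale-free form
`η₀ · κ_mod (c_*/2)^{J+1} / 16 ≤ M_u · A · 2 ((μ + δ)/d_R)^γ`.

All `[folklore]` glue; no named fact.

## References

* D. Chelkak, S. Smirnov, Invent. Math. 189 (2012) = arXiv:0910.2045, proof of Thm. 6.1, Remark 6.3. [ChelkakSmirnov2012Ising]
-/

noncomputable section

open Set Metric

namespace Literature.Probability.LatticeModels

open Site WeakBeurling Literature.Topology.PlaneTopology

namespace KCSignConfig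

variable {Ω G Bad : Set ℂ} (cfg : KCSignConfig Ω G Bad)

/-- The seed box radius `ρ = ⌊101 κ/δ⌋ + 2`. [folklore] -/
def ρS (δ : ℝ) : ℕ := ⌊101 * cfg.κ / δ⌋₊ + 2

/-- The dead box radius `R = ⌊Θ_R κ/δ⌋`. [folklore] -/
def RS (δ : ℝ) : ℕ := ⌊seedRatio * cfg.κ / δ⌋₊

/-- The dead-cemetery radius at the ends, `R_E = ⌊dR/δ⌋`. [folklore] -/
def RE (δ : ℝ) : ℕ := ⌊cfg.dR / δ⌋₊

namespace ScaleHyp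

variable {cfg} {δ μ : ℝ} {Λ : Finset (Site 2)} (H : ScaleHyp cfg δ Λ μ)
include H

/-! ### The seed -/

/-- The frozen site near the seed (a choice from visibility). [folklore] -/
def aS (H' : ScaleHyp cfg δ Λ μ) : Site 2 := Classical.choose H'.vis_seed

/-- Specification of `aS`. [folklore] -/
theorem aS_spec : H.aS ∉ Λ ∧ dist ((δ : ℂ) * toComplex H.aS) cfg.zStar ≤ 101 * cfg.κ := Classical.choose_spec H.vis_seed

/-- The frozen bond at the seed (a choice from hole-freeness). [folklore] -/
def k₀S (H' : ScaleHyp cfg δ Λ μ) : Fin 4 := Classical.choose (exists_bond_plaquette_of_frozen_corner H'.holeFree H'.aS_spec.1 0)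

/-- The bond plaquette index at the seed. [folklore] -/
def j₀S (H' : ScaleHyp cfg δ Λ μ) : Fin 4 :=
  Classical.choose (Classical.choose_spec (exists_bond_plaquette_of_frozen_corner H'.holeFree H'.aS_spec.1 0))

/-- Specification of the seed bond. [folklore] -/
theorem seedBond_spec : H.aS + cornerUnit H.k₀S ∉ Λ ∧ (H.j₀S = H.k₀S ∨ H.j₀S = H.k₀S + 3) := by
  obtain ⟨h1, h2, -⟩ := Classical.choose_spec (Classical.choose_spec (exists_bond_plaquette_of_frozen_corner H.holeFree H.aS_spec.1 0))
  exact ⟨h1, h2⟩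

/-- The indicator of the sites within sup-distance `R + 2` of the seed site. [folklore] -/
def gV (H' : ScaleHyp cfg δ Λ μ) (x : Site 2) : ℝ := if |x 0 - H'.aS 0| ≤ cfg.RS δ + 2 ∧ |x 1 - H'.aS 1| ≤ cfg.RS δ + 2 then 1 else 0

/-- `0 ≤ gV ≤ 1`. [folklore] -/
theorem gV_bounds (x : Site 2) : 0 ≤ H.gV x ∧ H.gV x ≤ 1 := by
  unfold gV; split_ifs <;> norm_num

/-- Bounds on `ρ`, `R`. [folklore] -/
theorem ρS_RS_bounds : ((cfg.ρS δ : ℝ) ≤ 101 * cfg.κ / δ + 2 ∧ 101 * cfg.κ / δ + 1 < cfg.ρS δ) ∧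
    ((cfg.RS δ : ℝ) ≤ seedRatio * cfg.κ / δ ∧ seedRatio * cfg.κ / δ < cfg.RS δ + 1) := by
  have hδ := H.δ_pos
  have h1 := Nat.floor_le (show 0 ≤ 101 * cfg.κ / δ by have := cfg.κ_pos; positivity)
  have h2 := Nat.lt_floor_add_one (101 * cfg.κ / δ)
  have h3 := Nat.floor_le (show 0 ≤ seedRatio * cfg.κ / δ by have := cfg.κ_pos; have := seedRatio_ge; positivity)
  have h4 := Nat.lt_floor_add_one (seedRatio * cfg.κ / δ)
  simp only [ρS, RS, Nat.cast_add, Nat.cast_ofNat]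
  exact ⟨⟨by linarith, by linarith⟩, h3, h4⟩

/-- **`hρR`**: the Beurling ratio of the seed boxes, `2C ((ρ+1)/(R+1))^β ≤ 1`. [folklore] -/
theorem hρR : 2 * beurlingConst * (((cfg.ρS δ : ℝ) + 1) / ((cfg.RS δ : ℝ) + 1)) ^ beurlingExp ≤ 1 := by
  obtain ⟨⟨hρ1, -⟩, -, hR2⟩ := H.ρS_RS_bounds
  have h100 := H.hundred_le_κ_div
  have hC := beurlingConst_pos
  have hβ := beurlingExp_pos
  set Θ : ℝ := (2 * beurlingConst) ^ (1 / beurlingExp) with hΘ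
  have hΘpos : 0 < Θ := Real.rpow_pos_of_pos (by positivity) _
  have hΘβ : Θ ^ beurlingExp = 2 * beurlingConst := by
    rw [hΘ, one_div, Real.rpow_inv_rpow (by positivity) hβ.ne']
  -- `ρ + 1 ≤ 102 κ/δ` and `R + 1 ≥ 104 Θ κ/δ ≥ Θ (ρ + 1)`
  have hratio : ((cfg.ρS δ : ℝ) + 1) / ((cfg.RS δ : ℝ) + 1) ≤ Θ⁻¹ := by
    rw [div_le_iff₀ (by positivity)]
    have h1 : ((cfg.ρS δ : ℝ) + 1) ≤ 102 * (cfg.κ / δ) := by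
      have : 101 * cfg.κ / δ = 101 * (cfg.κ / δ) := by ring
      linarith
    have h2 : seedRatio * cfg.κ / δ = 104 * Θ * (cfg.κ / δ) := by rw [seedRatio, hΘ]; ring
    -- `Θ⁻¹ (R + 1) ≥ Θ⁻¹ · 104 Θ κ/δ = 104 κ/δ`
    have h3 : Θ⁻¹ * ((cfg.RS δ : ℝ) + 1) ≥ 104 * (cfg.κ / δ) := by
      have : Θ⁻¹ * (104 * Θ * (cfg.κ / δ)) = 104 * (cfg.κ / δ) := by field_simp
      rw [← this]
      exact mul_le_mul_of_nonneg_left (by linarith) (inv_nonneg.2 hΘpos.le)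
    linarith
  calc 2 * beurlingConst * (((cfg.ρS δ : ℝ) + 1) / ((cfg.RS δ : ℝ) + 1)) ^ beurlingExp
      ≤ 2 * beurlingConst * (Θ⁻¹) ^ beurlingExp := by
        apply mul_le_mul_of_nonneg_left _ (by positivity)
        exact Real.rpow_le_rpow (by positivity) hratio hβ.le
    _ = 1 := by rw [Real.inv_rpow hΘpos.le, hΘβ]; field_simp

/-- The seed site is within sup-distance `101 κ/δ` of `zStar/δ` (coordinates). [folklore] -/
theorem aS_near : |((H.aS 0 : ℤ) : ℝ) - (cfg.zStar / δ).re| ≤ 101 * cfg.κ / δ ∧ |((H.aS 1 : ℤ) : ℝ) - (cfg.zStar / δ).im| ≤ 101 * cfg.κ / δ := by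
  have hδ := H.δ_pos
  have hδ' : (δ : ℂ) ≠ 0 := Complex.ofReal_ne_zero.2 hδ.ne'
  have hd := H.aS_spec.2
  have hd' : dist (toComplex H.aS) (cfg.zStar / δ) ≤ 101 * cfg.κ / δ := by
    have := dist_div_div hδ ((δ : ℂ) * toComplex H.aS) cfg.zStar
    rw [mul_div_cancel_left₀ _ hδ'] at this
    rw [this]; exact div_le_div_of_nonneg_right hd hδ.le
  rw [dist_eq_norm] at hd'
  constructor
  · have := (Complex.abs_re_le_norm (toComplex H.aS - cfg.zStar / δ)).trans hd'
    simpa [Complex.sub_re] using this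
  · have := (Complex.abs_im_le_norm (toComplex H.aS - cfg.zStar / δ)).trans hd'
    simpa [Complex.sub_im] using this

/-- **`hc0`**: the seed plaquette lies in the seed box `sqBox (faceAt aS j₀) ρ`. [folklore] -/
theorem f₀_mem_seedBox : cfg.f₀ δ ∈ sqBox (faceAt H.aS H.j₀S) (cfg.ρS δ) := by
  obtain ⟨h0, h1⟩ := H.aS_near
  obtain ⟨⟨-, hρ⟩, -⟩ := H.ρS_RS_bounds
  have hc := abs_sub_le_of_mem_plaqClosedSq (mem_plaqClosedSq_plaqOf (cfg.zStar / δ))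
  rw [← f₀] at hc
  simp only [plaqCentre] at hc
  obtain ⟨hc0, hc1⟩ := hc
  rw [abs_le] at h0 h1 hc0 hc1
  have hoff : (cornerOff H.j₀S 0 = 0 ∨ cornerOff H.j₀S 0 = 1) ∧ (cornerOff H.j₀S 1 = 0 ∨ cornerOff H.j₀S 1 = 1) := by
    rcases H.j₀S with j; fin_cases j <;> simp
  rw [mem_sqBox]
  constructor
  · have key : |((cfg.f₀ δ 0 - faceAt H.aS H.j₀S 0 : ℤ) : ℝ)| ≤ cfg.ρS δ := by
      simp only [faceAt_apply]; push_cast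
      rw [abs_le]
      rcases hoff.1 with h | h <;> rw [h] <;> push_cast <;> constructor <;> linarith [h0.1, h0.2, hc0.1, hc0.2]
    exact_mod_cast key
  · have key : |((cfg.f₀ δ 1 - faceAt H.aS H.j₀S 1 : ℤ) : ℝ)| ≤ cfg.ρS δ := by
      simp only [faceAt_apply]; push_cast
      rw [abs_le]
      rcases hoff.2 with h | h <;> rw [h] <;> push_cast <;> constructor <;> linarith [h1.1, h1.2, hc1.1, hc1.2]
    exact_mod_cast key

/-- **`hE`**: `gV = 1` at the corners of the plaquettes of the dead box `sqBox (faceAt aS j₀) R`. [folklore] -/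
theorem hE : ∀ w ∈ cfg.Dreg δ Λ μ, w ∈ sqBox (faceAt H.aS H.j₀S) (cfg.RS δ) → ∀ j : Fin 4, ¬ SideTouch Λ w j → H.gV (w + cornerOff j) = 1 := by
  intro w _ hw j _
  obtain ⟨h0, h1⟩ := corner_sub_le_of_mem_sqBox hw j
  have hoff : (cornerOff H.j₀S 0 = 0 ∨ cornerOff H.j₀S 0 = 1) ∧ (cornerOff H.j₀S 1 = 0 ∨ cornerOff H.j₀S 1 = 1) := by
    rcases H.j₀S with j; fin_cases j <;> simp
  simp only [faceAt_apply] at h0 h1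
  unfold gV
  rw [if_pos]
  rw [abs_le] at h0 h1 ⊢; rw [abs_le]
  constructor
  · rcases hoff.1 with h | h <;> rw [h] at h0 <;> omega
  · rcases hoff.2 with h | h <;> rw [h] at h1 <;> omega

/-- Plaquettes all of whose closed square scales to within `seedClear κ` of the seed are not avoided. [folklore] -/
theorem not_mem_CsetL_of_near_zStar {f : Site 2} (hf : ∀ w ∈ plaqClosedSq f, dist ((δ : ℂ) * w) cfg.zStar ≤ seedClear * cfg.κ) :
    f ∉ cfg.CsetL δ Λ μ := by
  rintro ⟨w, hwf, hwC, -⟩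
  exact absurd (hf w hwf) (not_le.2 (H.dist_zStar_gt_of_mem_contourL hwC))

/-- Sites within sup-distance `R + 3` of the seed site scale to within `(2 Θ_R + 110) κ` of `zStar`. [folklore] -/
theorem dist_zStar_le_of_near_aS {w : ℂ} (h0 : |w.re - (H.aS 0 : ℝ)| ≤ cfg.RS δ + 3) (h1 : |w.im - (H.aS 1 : ℝ)| ≤ cfg.RS δ + 3) :
    dist ((δ : ℂ) * w) cfg.zStar ≤ (2 * seedRatio + 110) * cfg.κ := by
  have hδ := H.δ_pos
  obtain ⟨-, hR, -⟩ := H.ρS_RS_bounds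
  have hδκ := H.δ_le_κ
  have hd := H.aS_spec.2
  have h2 : dist ((δ : ℂ) * w) ((δ : ℂ) * toComplex H.aS) ≤ δ * (2 * (cfg.RS δ : ℝ) + 6) := by
    rw [H.dist_scale, dist_eq_norm]
    apply mul_le_mul_of_nonneg_left _ hδ.le
    refine (Complex.norm_le_abs_re_add_abs_im _).trans ?_
    simp only [Complex.sub_re, Complex.sub_im, toComplex_re, toComplex_im]
    linarith
  have h3 : δ * (2 * (cfg.RS δ : ℝ) + 6) ≤ 2 * seedRatio * cfg.κ + 6 * δ := by
    have : δ * (cfg.RS δ : ℝ) ≤ seedRatio * cfg.κ := by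
      calc δ * (cfg.RS δ : ℝ) ≤ δ * (seedRatio * cfg.κ / δ) := mul_le_mul_of_nonneg_left hR hδ.le
        _ = seedRatio * cfg.κ := by field_simp
    nlinarith
  linarith [dist_triangle ((δ : ℂ) * w) ((δ : ℂ) * toComplex H.aS) cfg.zStar]

/-- **`hclosed`**: touching steps from `D` into the dead box stay in `D` (the dead box misses the
avoided set). [folklore] -/
theorem hclosed : ∀ v ∈ cfg.Dreg δ Λ μ, (∀ j : Fin 4, SideTouch Λ v j) → ∀ m : Fin 4,
    v + cornerUnit m ∈ sqBox (faceAt H.aS H.j₀S) (cfg.RS δ) → v + cornerUnit m ∈ cfg.Dreg δ Λ μ := by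
  intro v hv hall m hbox
  refine add_cornerUnit_mem_touchReach H.f₀_not_mem_CsetL hv m hall (H.not_mem_CsetL_of_near_zStar fun w hw => ?_)
  obtain ⟨h0, h1⟩ := hbox
  have hoff : (cornerOff H.j₀S 0 = 0 ∨ cornerOff H.j₀S 0 = 1) ∧ (cornerOff H.j₀S 1 = 0 ∨ cornerOff H.j₀S 1 = 1) := by
    rcases H.j₀S with j; fin_cases j <;> simp
  simp only [faceAt_apply] at h0 h1
  obtain ⟨hw1, hw2, hw3, hw4⟩ := hw
  have hz0 : -((cfg.RS δ : ℤ) + 1) ≤ (v + cornerUnit m) 0 - H.aS 0 ∧ (v + cornerUnit m) 0 - H.aS 0 ≤ cfg.RS δ + 1 := by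
    rw [abs_le] at h0; rcases hoff.1 with h | h <;> rw [h] at h0 <;> omega
  have hz1 : -((cfg.RS δ : ℤ) + 1) ≤ (v + cornerUnit m) 1 - H.aS 1 ∧ (v + cornerUnit m) 1 - H.aS 1 ≤ cfg.RS δ + 1 := by
    rw [abs_le] at h1; rcases hoff.2 with h | h <;> rw [h] at h1 <;> omega
  have h0' : |(((v + cornerUnit m) 0 : ℤ) : ℝ) - (H.aS 0 : ℝ)| ≤ cfg.RS δ + 1 := by
    have e1 : ((-((cfg.RS δ : ℤ) + 1) : ℤ) : ℝ) ≤ (((v + cornerUnit m) 0 - H.aS 0 : ℤ) : ℝ) := by exact_mod_cast hz0.1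
    have e2 : (((v + cornerUnit m) 0 - H.aS 0 : ℤ) : ℝ) ≤ ((cfg.RS δ + 1 : ℤ) : ℝ) := by exact_mod_cast hz0.2
    push_cast at e1 e2
    rw [abs_le]; constructor <;> linarith
  have h1' : |(((v + cornerUnit m) 1 : ℤ) : ℝ) - (H.aS 1 : ℝ)| ≤ cfg.RS δ + 1 := by
    have e1 : ((-((cfg.RS δ : ℤ) + 1) : ℤ) : ℝ) ≤ (((v + cornerUnit m) 1 - H.aS 1 : ℤ) : ℝ) := by exact_mod_cast hz1.1
    have e2 : (((v + cornerUnit m) 1 - H.aS 1 : ℤ) : ℝ) ≤ ((cfg.RS δ + 1 : ℤ) : ℝ) := by exact_mod_cast hz1.2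
    push_cast at e1 e2
    rw [abs_le]; constructor <;> linarith
  refine (H.dist_zStar_le_of_near_aS (w := w) ?_ ?_).trans ?_
  · rw [abs_le] at h0' ⊢; constructor <;> linarith
  · rw [abs_le] at h1' ⊢; constructor <;> linarith
  · have := seedRatio_ge; have := cfg.κ_pos
    rw [seedClear]; nlinarith

/-- **`hu0`**: where `gV ≠ 0` and a corner is frozen, `u ≥ 0` (the seed box lies in `G`, where
the boundary sign of the Kadanoff–Ceva structure holds). [folklore] -/
theorem hu0 {u : Site 2 → ℝ} (hU0 : ∀ f : Site 2, (∃ i : Fin 4, f + cornerOff i ∉ Λ) → (δ : ℂ) * plaqCentre f ∈ G → 0 ≤ u f) :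
    ∀ f ∈ cfg.Dreg δ Λ μ, ∀ j : Fin 4, ¬ SideTouch Λ f j → 0 ≤ u f * H.gV (f + cornerOff j) := by
  intro f _ j hj
  unfold gV
  split_ifs with h
  · rw [mul_one]
    refine hU0 f ⟨j, fun hc => hj (Or.inl hc)⟩ (cfg.seedBall_subset ?_)
    rw [mem_closedBall]
    obtain ⟨h0, h1⟩ := h
    have hoff : (cornerOff j 0 = 0 ∨ cornerOff j 0 = 1) ∧ (cornerOff j 1 = 0 ∨ cornerOff j 1 = 1) := by fin_cases j <;> simp
    simp only [Pi.add_apply] at h0 h1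
    refine (H.dist_zStar_le_of_near_aS ?_ ?_).trans ?_
    · have : |((f 0 + cornerOff j 0 - H.aS 0 : ℤ) : ℝ)| ≤ cfg.RS δ + 2 := by exact_mod_cast h0
      simp only [plaqCentre]; push_cast at this
      rw [abs_le] at this ⊢; rcases hoff.1 with h | h <;> rw [h] at this <;> push_cast at this <;> constructor <;> linarith
    · have : |((f 1 + cornerOff j 1 - H.aS 1 : ℤ) : ℝ)| ≤ cfg.RS δ + 2 := by exact_mod_cast h1
      simp only [plaqCentre]; push_cast at this
      rw [abs_le] at this ⊢; rcases hoff.2 with h | h <;> rw [h] at this <;> push_cast at this <;> constructor <;> linarith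
    · have := seedRatio_ge; have := cfg.κ_pos
      rw [seedClear]; nlinarith
  · rw [mul_zero]

/-! ### The two ends -/

/-- The first run plaquette of end `e`, `c₀^e = faceAt a_e j₁^e`. [folklore] -/
def cE (_H : ScaleHyp cfg δ Λ μ) (e : Fin 2) : Site 2 := faceAt (cfg.aEnd δ Λ e) (cfg.jOne δ Λ e)

/-- The frozen bond at end `e` (a choice from hole-freeness). [folklore] -/
def kE (H' : ScaleHyp cfg δ Λ μ) (e : Fin 2) : Fin 4 :=
  Classical.choose (exists_bond_plaquette_of_frozen_corner H'.holeFree (cfg.aEnd_spec δ Λ e).1 (cfg.jOne δ Λ e))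

/-- The bond plaquette index at end `e`. [folklore] -/
def jE (H' : ScaleHyp cfg δ Λ μ) (e : Fin 2) : Fin 4 :=
  Classical.choose (Classical.choose_spec (exists_bond_plaquette_of_frozen_corner H'.holeFree (cfg.aEnd_spec δ Λ e).1 (cfg.jOne δ Λ e)))

/-- **`haE`**: the end data — frozen site, frozen bond, bond plaquette equal or adjacent to `c₀^e`. [folklore] -/
theorem haE (e : Fin 2) : cfg.aEnd δ Λ e ∉ Λ ∧ cfg.aEnd δ Λ e + cornerUnit (H.kE e) ∉ Λ ∧ (H.jE e = H.kE e ∨ H.jE e = H.kE e + 3) ∧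
    (H.cE e = faceAt (cfg.aEnd δ Λ e) (H.jE e) ∨ (zdGraph 2).Adj (H.cE e) (faceAt (cfg.aEnd δ Λ e) (H.jE e))) := by
  obtain ⟨h1, h2, h3⟩ := Classical.choose_spec (Classical.choose_spec
    (exists_bond_plaquette_of_frozen_corner H.holeFree (cfg.aEnd_spec δ Λ e).1 (cfg.jOne δ Λ e)))
  exact ⟨(cfg.aEnd_spec δ Λ e).1, h1, h2, h3⟩

/-- The run plaquettes of end `e` from `cE`: `runPt (cE e) (kDir e) n = endRunPt … e n`. [folklore] -/
theorem runPt_cE (e : Fin 2) (n : ℤ) : runPt (H.cE e) (cfg.kDir δ Λ e) n = endRunPt (cfg.aEnd δ Λ) (cfg.kDir δ Λ) (cfg.jOne δ Λ) e n := rfl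

/-- Bounds on `R_E`: `dR/δ - 1 < R_E ≤ dR/δ`, and `2L + 2 ≤ R_E`. [folklore] -/
theorem RE_bounds : ((cfg.RE δ : ℝ) ≤ cfg.dR / δ ∧ cfg.dR / δ < cfg.RE δ + 1) ∧ 2 * Lend δ μ + 2 ≤ cfg.RE δ := by
  have hδ := H.δ_pos
  have h1 := Nat.floor_le (div_nonneg cfg.dR_pos.le hδ.le)
  have h2 := Nat.lt_floor_add_one (cfg.dR / δ)
  refine ⟨⟨h1, h2⟩, ?_⟩
  have hL : (Lend δ μ : ℝ) * δ ≤ μ := H.Lend_mul_le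
  have hμ := H.μ_le_dR; have hδd := H.δ_le_dR
  have key : (2 * (Lend δ μ : ℝ) + 2) < cfg.RE δ + 1 := by
    have : (2 * (Lend δ μ : ℝ) + 2) * δ ≤ cfg.dR - δ := by nlinarith
    rw [RE]
    calc (2 * (Lend δ μ : ℝ) + 2) ≤ (cfg.dR - δ) / δ := by rw [le_div_iff₀ hδ]; exact this
      _ = cfg.dR / δ - 1 := by field_simp
      _ < _ := by linarith
  have : 2 * Lend δ μ + 2 < cfg.RE δ + 1 := by exact_mod_cast key
  omega

/-- **`hLE`**: `1 ≤ L` and `2L + 2 ≤ R_E`. [folklore] -/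
theorem hLE : 1 ≤ Lend δ μ ∧ 2 * Lend δ μ + 2 ≤ cfg.RE δ := ⟨H.one_le_Lend, H.RE_bounds.2⟩

/-- **`hrunE`**: the run plaquettes `c_n^e`, `0 ≤ n ≤ 2L`, are off `D`. [folklore] -/
theorem hrunE (e : Fin 2) : ∀ n : ℤ, 0 ≤ n → n ≤ 2 * Lend δ μ → runPt (H.cE e) (cfg.kDir δ Λ e) n ∉ cfg.Dreg δ Λ μ := by
  intro n hn0 hnL hD
  obtain ⟨n', rfl⟩ := Int.eq_ofNat_of_zero_le hn0
  refine H.not_mem_CsetL_of_mem_Dreg hD ?_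
  rw [runPt_cE]
  exact endRunPt_mem_Cset _ _ _ _ _ _ _ e (by rw [Nrun]; omega)

/-- **`hconeE`**: the lateral half-boxes of the run plaquettes `c_i^e`, `8 ≤ i ≤ L`, consist of
plaquettes touching `Λ` across every side. [folklore] -/
theorem hconeE (e : Fin 2) : ∀ i : ℕ, 8 ≤ i → i ≤ Lend δ μ → ∀ m : Fin 4, (m = cfg.kDir δ Λ e + 1 ∨ m = cfg.kDir δ Λ e + 3) →
    ∀ z ∈ flatHalfBox m (runPt (H.cE e) (cfg.kDir δ Λ e) i) (i / 8) (i / 8), z ∈ cfg.Dreg δ Λ μ → ∀ j : Fin 4, SideTouch Λ z j := by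
  intro i hi8 hiL m hm z hz _ j
  refine (cfg.endRun_spec δ Λ e).1 i hi8 ?_ m hm z hz j
  have := H.two_mul_Nrun_add_one_le e
  have hiL' : (i : ℝ) ≤ Lend δ μ := by exact_mod_cast hiL
  simp only [Nrun, Nat.cast_add, Nat.cast_mul, Nat.cast_ofNat] at this
  linarith

/-- **`hcarry`**: every non-`Mid` exit target is a run plaquette `c_i^e`, `i ≤ L`. [folklore] -/
theorem hcarry : ∀ f ∈ cfg.Dreg δ Λ μ, ∀ j : Fin 4, SideTouch Λ f j → sideNbr f j ∉ cfg.Dreg δ Λ μ → ¬ H.Mid (sideNbr f j) →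
    ∃ e ∈ (Finset.univ : Finset (Fin 2)), ∃ i : ℕ, i ≤ Lend δ μ ∧ sideNbr f j = runPt (H.cE e) (cfg.kDir δ Λ e) i := by
  intro f hf j hj hn hmid
  have hC : sideNbr f j ∈ cfg.CsetL δ Λ μ := mem_avoid_of_exit H.f₀_not_mem_CsetL hf hj hn
  obtain ⟨e, i, hi, he⟩ := H.exists_eq_endRunPt_of_mem_CsetL_not_mid hC hmid
  exact ⟨e, Finset.mem_univ _, i, hi, he⟩

/-- **`hdeadE`**: the dead boxes at the ends (radius `R_E` about `c₀^e`) carry `gV = 0` (they are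
far from the seed). [folklore] -/
theorem hdeadE (e : Fin 2) : ∀ g ∈ cfg.Dreg δ Λ μ, g ∈ sqBox (H.cE e) (cfg.RE δ) → ∀ j : Fin 4, ¬ SideTouch Λ g j → H.gV (g + cornerOff j) = 0 := by
  intro g _ hg j _
  unfold gV
  rw [if_neg]
  intro hnear
  have hδ := H.δ_pos
  -- the corner is within `R_E + 2` of `cE e`, which is within `1` of `a_e`
  obtain ⟨h0, h1⟩ := corner_sub_le_of_mem_sqBox hg j
  have hoff : (cornerOff (cfg.jOne δ Λ e) 0 = 0 ∨ cornerOff (cfg.jOne δ Λ e) 0 = 1) ∧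
      (cornerOff (cfg.jOne δ Λ e) 1 = 0 ∨ cornerOff (cfg.jOne δ Λ e) 1 = 1) := by
    rcases cfg.jOne δ Λ e with jj; fin_cases jj <;> simp
  simp only [cE, faceAt_apply] at h0 h1
  -- distances in the continuum: the corner is within `2 (R_E + 2) δ ≤ 2 dR + 4 δ` of `δ a_e`
  have hca : dist ((δ : ℂ) * toComplex (g + cornerOff j)) ((δ : ℂ) * toComplex (cfg.aEnd δ Λ e)) ≤ 2 * cfg.dR + 4 * δ := by
    rw [H.dist_scale, dist_eq_norm]
    have hR := H.RE_bounds.1.1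
    have hz0 : -((cfg.RE δ : ℤ) + 2) ≤ (g + cornerOff j) 0 - cfg.aEnd δ Λ e 0 ∧ (g + cornerOff j) 0 - cfg.aEnd δ Λ e 0 ≤ cfg.RE δ + 2 := by
      rw [abs_le] at h0; rcases hoff.1 with h | h <;> rw [h] at h0 <;> omega
    have hz1 : -((cfg.RE δ : ℤ) + 2) ≤ (g + cornerOff j) 1 - cfg.aEnd δ Λ e 1 ∧ (g + cornerOff j) 1 - cfg.aEnd δ Λ e 1 ≤ cfg.RE δ + 2 := by
      rw [abs_le] at h1; rcases hoff.2 with h | h <;> rw [h] at h1 <;> omega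
    have e01 : ((-((cfg.RE δ : ℤ) + 2) : ℤ) : ℝ) ≤ (((g + cornerOff j) 0 - cfg.aEnd δ Λ e 0 : ℤ) : ℝ) := by exact_mod_cast hz0.1
    have e02 : (((g + cornerOff j) 0 - cfg.aEnd δ Λ e 0 : ℤ) : ℝ) ≤ ((cfg.RE δ + 2 : ℤ) : ℝ) := by exact_mod_cast hz0.2
    have e11 : ((-((cfg.RE δ : ℤ) + 2) : ℤ) : ℝ) ≤ (((g + cornerOff j) 1 - cfg.aEnd δ Λ e 1 : ℤ) : ℝ) := by exact_mod_cast hz1.1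
    have e12 : (((g + cornerOff j) 1 - cfg.aEnd δ Λ e 1 : ℤ) : ℝ) ≤ ((cfg.RE δ + 2 : ℤ) : ℝ) := by exact_mod_cast hz1.2
    push_cast at e01 e02 e11 e12
    have hn : ‖toComplex (g + cornerOff j) - toComplex (cfg.aEnd δ Λ e)‖ ≤ 2 * (cfg.RE δ : ℝ) + 4 := by
      refine (Complex.norm_le_abs_re_add_abs_im _).trans ?_
      simp only [Complex.sub_re, Complex.sub_im, toComplex_re, toComplex_im]
      rw [show ((((g + cornerOff j) 0 : ℤ)) : ℝ) - (cfg.aEnd δ Λ e 0 : ℝ) = (((g + cornerOff j) 0 - cfg.aEnd δ Λ e 0 : ℤ) : ℝ) by push_cast; ring,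
        show ((((g + cornerOff j) 1 : ℤ)) : ℝ) - (cfg.aEnd δ Λ e 1 : ℝ) = (((g + cornerOff j) 1 - cfg.aEnd δ Λ e 1 : ℤ) : ℝ) by push_cast; ring]
      push_cast
      have a0 : |((g + cornerOff j) 0 : ℝ) - (cfg.aEnd δ Λ e 0 : ℝ)| ≤ (cfg.RE δ : ℝ) + 2 := by rw [abs_le]; constructor <;> linarith
      have a1 : |((g + cornerOff j) 1 : ℝ) - (cfg.aEnd δ Λ e 1 : ℝ)| ≤ (cfg.RE δ : ℝ) + 2 := by rw [abs_le]; constructor <;> linarith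
      linarith
    calc δ * ‖toComplex (g + cornerOff j) - toComplex (cfg.aEnd δ Λ e)‖ ≤ δ * (2 * (cfg.RE δ : ℝ) + 4) :=
          mul_le_mul_of_nonneg_left hn hδ.le
      _ ≤ 2 * cfg.dR + 4 * δ := by
        have : δ * (cfg.RE δ : ℝ) ≤ cfg.dR := by
          calc δ * (cfg.RE δ : ℝ) ≤ δ * (cfg.dR / δ) := mul_le_mul_of_nonneg_left hR hδ.le
            _ = cfg.dR := by field_simp
        nlinarith
  -- `δ a_e` is in the end zone, hence far from the seed
  have hfar : 2 * cfg.dR + seedClear * cfg.κ ≤ dist ((δ : ℂ) * toComplex (cfg.aEnd δ Λ e)) cfg.zStar := by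
    refine cfg.far_end_seed e _ ?_
    have h1 : l1norm ((δ : ℂ) * toComplex (cfg.aEnd δ Λ e) - cfg.z₀ e) = δ * cfg.mEnd δ Λ e := by
      rw [mEnd, Zl, l1dist_div H.δ_pos, ← mul_div_assoc, mul_comm δ, mul_div_cancel_right₀ _ H.δ_pos.ne']
    rw [h1]
    linarith [H.δ_mul_mEnd_le e, H.μ_le_slack]
  -- but a site with `gV ≠ 0` is close to the seed
  obtain ⟨hn0, hn1⟩ := hnear
  have hclose : dist ((δ : ℂ) * toComplex (g + cornerOff j)) cfg.zStar ≤ (2 * seedRatio + 110) * cfg.κ := by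
    refine H.dist_zStar_le_of_near_aS ?_ ?_
    · have e1 : ((-((cfg.RS δ : ℤ) + 2) : ℤ) : ℝ) ≤ (((g + cornerOff j) 0 - H.aS 0 : ℤ) : ℝ) := by exact_mod_cast (abs_le.1 hn0).1
      have e2 : (((g + cornerOff j) 0 - H.aS 0 : ℤ) : ℝ) ≤ ((cfg.RS δ + 2 : ℤ) : ℝ) := by exact_mod_cast (abs_le.1 hn0).2
      push_cast at e1 e2
      simp only [toComplex_re]; rw [abs_le]; constructor <;> linarith
    · have e1 : ((-((cfg.RS δ : ℤ) + 2) : ℤ) : ℝ) ≤ (((g + cornerOff j) 1 - H.aS 1 : ℤ) : ℝ) := by exact_mod_cast (abs_le.1 hn1).1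
      have e2 : (((g + cornerOff j) 1 - H.aS 1 : ℤ) : ℝ) ≤ ((cfg.RS δ + 2 : ℤ) : ℝ) := by exact_mod_cast (abs_le.1 hn1).2
      push_cast at e1 e2
      simp only [toComplex_im]; rw [abs_le]; constructor <;> linarith
  have htri := dist_triangle ((δ : ℂ) * toComplex (cfg.aEnd δ Λ e)) ((δ : ℂ) * toComplex (g + cornerOff j)) cfg.zStar
  rw [dist_comm ((δ : ℂ) * toComplex (cfg.aEnd δ Λ e)) ((δ : ℂ) * toComplex (g + cornerOff j))] at htri
  have := seedRatio_ge; have := cfg.κ_pos; have := H.δ_le_κ; have := cfg.dR_pos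
  rw [seedClear] at hfar
  nlinarith

end ScaleHyp

/-! ### The geometry of the winding certificate -/

/-- `dirVec (k+1) = i · dirVec k`. [folklore] -/
theorem dirVec_succ (k : Fin 4) : dirVec (k + 1) = Complex.I * dirVec k := by
  obtain ⟨h0, h1⟩ := cornerUnit_succ_apply k
  apply Complex.ext <;> simp [dirVec, toComplex, h0, h1]

/-- **The sides of the flat piece**: `q₁` is strictly on the positive and `q₂` strictly on the
negative side of the line from `yMinus` to `yPlus` (`segSide = ± len · ℓ`). [folklore] -/
theorem segSide_yMinus_yPlus : segSide cfg.yMinus cfg.yPlus cfg.q₁ = cfg.len * cfg.ℓ ∧ segSide cfg.yMinus cfg.yPlus cfg.q₂ = -(cfg.len * cfg.ℓ) := by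
  have hn : (cornerUnit cfg.km 0 : ℝ) ^ 2 + (cornerUnit cfg.km 1 : ℝ) ^ 2 = 1 := by
    rcases cornerUnit_apply_cases cfg.km with ⟨h0, h1⟩ | ⟨h0, h1⟩ | ⟨h0, h1⟩ | ⟨h0, h1⟩ <;> simp [h0, h1]
  simp only [segSide_eq, yMinus, yPlus, q₁, q₂, dirVec_succ, Complex.sub_re, Complex.sub_im, Complex.add_re, Complex.add_im,
    Complex.mul_re, Complex.mul_im, Complex.ofReal_re, Complex.ofReal_im, Complex.I_re, Complex.I_im, dirVec_re, dirVec_im]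
  constructor
  · linear_combination (cfg.len * cfg.ℓ) * hn
  · linear_combination (-(cfg.len * cfg.ℓ)) * hn

/-- Division by the mesh as a real scalar action. [folklore] -/
theorem div_eq_inv_smul {δ : ℝ} (x : ℂ) : x / (δ : ℂ) = (0 : ℂ) + (δ⁻¹ : ℝ) • x := by
  rw [zero_add, Complex.real_smul, Complex.ofReal_inv, div_eq_inv_mul]

/-- The sides of the scaled flat piece. [folklore] -/
theorem segSide_scaled {δ : ℝ} (hδ : 0 < δ) :
    0 < segSide (cfg.yMinus / δ) (cfg.yPlus / δ) (cfg.q₁ / δ) ∧ segSide (cfg.yMinus / δ) (cfg.yPlus / δ) (cfg.q₂ / δ) < 0 := by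
  obtain ⟨h1, h2⟩ := cfg.segSide_yMinus_yPlus
  have hpos : 0 < cfg.len * cfg.ℓ := mul_pos cfg.len_pos cfg.ℓ_pos
  rw [div_eq_inv_smul cfg.yMinus, div_eq_inv_smul cfg.yPlus, div_eq_inv_smul cfg.q₁, div_eq_inv_smul cfg.q₂,
    segSide_translate_smul, segSide_translate_smul, h1, h2]
  have : 0 < (δ⁻¹) ^ 2 := by positivity
  constructor <;> nlinarith

/-- The midpoint `pmid/δ` lies on the scaled flat piece and strictly inside the scaled normal segment. [folklore] -/
theorem pmid_mem_cross (δ : ℝ) :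
    ∃ p ∈ segment ℝ (cfg.q₁ / δ) (cfg.q₂ / δ), p ∈ openSegment ℝ (cfg.yMinus / δ) (cfg.yPlus / δ) := by
  refine ⟨cfg.pmid / δ, ?_, ?_⟩
  · rw [segment_eq_image']
    refine ⟨1 / 2, ⟨by norm_num, by norm_num⟩, ?_⟩
    simp only [q₁, q₂]; rw [Complex.real_smul]; push_cast; ring
  · refine ⟨1 / 2, 1 / 2, by norm_num, by norm_num, by norm_num, ?_⟩
    simp only [yMinus, yPlus]; rw [Complex.real_smul, Complex.real_smul]; push_cast; ring

/-- Frame coordinates are bounded by the norm. [folklore] -/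
theorem abs_dirCoord_le_norm (k : Fin 4) (v : ℂ) : |dirCoord k v| ≤ ‖v‖ ∧ |dirCoord (k + 1) v| ≤ ‖v‖ :=
  (abs_dirCoord_le_iff k v ‖v‖).2 ⟨Complex.abs_re_le_norm v, Complex.abs_im_le_norm v⟩

/-- Points of the scaled normal segment scale to `pmid + s e_{km}`, `|s| ≤ ℓ`: normal coordinate at
most `ℓ`, tangential coordinate `0`. [folklore] -/
theorem frame_of_mem_normalSeg {δ : ℝ} (hδ : 0 < δ) {w : ℂ} (hw : w ∈ segment ℝ (cfg.yMinus / δ) (cfg.yPlus / δ)) :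
    |dirCoord cfg.km ((δ : ℂ) * w - cfg.pmid)| ≤ cfg.ℓ ∧ dirCoord (cfg.km + 1) ((δ : ℂ) * w - cfg.pmid) = 0 := by
  have hδ' : (δ : ℂ) ≠ 0 := Complex.ofReal_ne_zero.2 hδ.ne'
  rw [segment_eq_image'] at hw
  obtain ⟨θ, ⟨hθ0, hθ1⟩, rfl⟩ := hw
  have : (δ : ℂ) * (cfg.yMinus / δ + θ • (cfg.yPlus / δ - cfg.yMinus / δ)) - cfg.pmid = (((2 * θ - 1) * cfg.ℓ : ℝ) : ℂ) * dirVec cfg.km := by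
    simp only [yMinus, yPlus]; rw [Complex.real_smul]; push_cast; field_simp; ring
  rw [this, dirCoord_mul_dirVec_self, dirCoord_succ_mul_dirVec]
  refine ⟨?_, rfl⟩
  rw [abs_le]
  have := cfg.ℓ_pos
  constructor <;> nlinarith

/-- Scaling a continuum path to lattice units. [folklore] -/
def scalePath (δ : ℝ) {x y : ℂ} (γ : Path x y) : Path (x / δ) (y / δ) := γ.map (continuous_div_const' δ)

/-- Values of the scaled path. [folklore] -/
theorem scalePath_apply {δ : ℝ} (hδ : 0 < δ) {x y : ℂ} (γ : Path x y) (t : unitInterval) : (δ : ℂ) * scalePath δ γ t = γ t := by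
  have hδ' : (δ : ℂ) ≠ 0 := Complex.ofReal_ne_zero.2 hδ.ne'
  show (δ : ℂ) * (γ t / δ) = γ t
  rw [mul_div_cancel₀ _ hδ']

/-- A plaquette touching `Λ` across a side has a free corner. [folklore] -/
theorem exists_corner_of_sideTouch {Λ : Finset (Site 2)} {f : Site 2} {j : Fin 4} (h : SideTouch Λ f j) : ∃ i : Fin 4, f + cornerOff i ∈ Λ := by
  rcases h with h | h
  · exact ⟨j, h⟩
  · exact ⟨j + 1, by rw [← add_cornerUnit_add_cornerOff, add_right_comm]; exact h⟩

namespace ScaleHyp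

variable {cfg} {δ μ : ℝ} {Λ : Finset (Site 2)} (H : ScaleHyp cfg δ Λ μ)
include H

/-- Points of the end pieces scale into the `(mInf e + μ/8)`-diamonds. [folklore] -/
theorem l1norm_scale_le_of_mem_endPath {e : Fin 2} {w : ℂ}
    (hw : w ∈ range (endPath (cfg.aEnd δ Λ) (cfg.kDir δ Λ) (cfg.jOne δ Λ) (Nrun δ μ) (cfg.Zl δ) e)) :
    l1norm ((δ : ℂ) * w - cfg.z₀ e) ≤ cfg.mInf e + μ / 8 := by
  have h0 := H.l1norm_runCentre_le e (Nat.zero_le _)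
  have hN := H.l1norm_runCentre_le e le_rfl
  simp only [Nat.cast_zero, sub_zero] at h0
  have hle := l1norm_le_of_mem_range_endPath (cfg.aEnd δ Λ) (cfg.kDir δ Λ) (cfg.jOne δ Λ) (Nrun δ μ) (cfg.Zl δ) e
    (by rw [mEnd] at h0; exact h0) (by rw [mEnd] at hN; exact hN.trans (by simp)) hw
  have := H.l1norm_scale_le (e := e) (w := w) (t := 0) (by rw [mEnd]; simpa using hle)
  simpa using this

/-- **`hpieces`**: the middle paths and the end pieces miss the scaled normal segment. [folklore] -/
theorem hpieces : ∀ w ∈ range (cfg.M₁l δ) ∪ range (cfg.M₂l δ) ∪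
      range (endPath (cfg.aEnd δ Λ) (cfg.kDir δ Λ) (cfg.jOne δ Λ) (Nrun δ μ) (cfg.Zl δ) 0) ∪
      range (endPath (cfg.aEnd δ Λ) (cfg.kDir δ Λ) (cfg.jOne δ Λ) (Nrun δ μ) (cfg.Zl δ) 1),
    w ∉ segment ℝ (cfg.yMinus / δ) (cfg.yPlus / δ) := by
  intro w hw hseg
  have hδ := H.δ_pos
  have hδ' : (δ : ℂ) ≠ 0 := Complex.ofReal_ne_zero.2 hδ.ne'
  obtain ⟨hn, ht⟩ := cfg.frame_of_mem_normalSeg hδ hseg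
  have hℓ := cfg.ℓ_pos
  have hbox1 : |dirCoord cfg.km ((δ : ℂ) * w - cfg.pmid)| ≤ 2 * cfg.ℓ := hn.trans (by linarith)
  have hbox2 : |dirCoord (cfg.km + 1) ((δ : ℂ) * w - cfg.pmid)| ≤ 2 * cfg.ℓ := by rw [ht, abs_zero]; linarith
  obtain ⟨hm1, hm2⟩ := cfg.clearBox_mid _ hbox1 hbox2
  rcases hw with ((⟨t, rfl⟩ | ⟨t, rfl⟩) | hw) | hw
  · apply hm1
    refine ⟨t, ?_⟩
    show cfg.M₁ t = δ * (cfg.M₁l δ) t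
    have : (cfg.M₁l δ) t = cfg.M₁ t / δ := rfl
    rw [this, mul_div_cancel₀ _ hδ']
  · apply hm2
    refine ⟨t, ?_⟩
    show cfg.M₂ t = δ * (cfg.M₂l δ) t
    have : (cfg.M₂l δ) t = cfg.M₂ t / δ := rfl
    rw [this, mul_div_cancel₀ _ hδ']
  · have h1 := H.l1norm_scale_le_of_mem_endPath hw
    have h2 := cfg.clearBox_end _ hbox1 hbox2 0
    linarith [H.μ_le_slack]
  · have h1 := H.l1norm_scale_le_of_mem_endPath hw
    have h2 := cfg.clearBox_end _ hbox1 hbox2 1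
    linarith [H.μ_le_slack]

/-- **`hSk`**: the frozen skeleton misses the scaled normal segment (the clear box is free bulk). [folklore] -/
theorem hSk : ∀ w ∈ frozenSkeleton Λ, w ∉ segment ℝ (cfg.yMinus / δ) (cfg.yPlus / δ) := by
  intro w hw hseg
  have hδ := H.δ_pos
  refine not_mem_frozenSkeleton_of_dist (fun a ha => ?_) hw
  by_contra hle
  push Not at hle
  apply ha
  apply H.bulk
  refine Or.inl (Or.inl (Or.inl (Or.inr ?_)))
  obtain ⟨hn, ht⟩ := cfg.frame_of_mem_normalSeg hδ hseg
  have hd : ‖(δ : ℂ) * toComplex a - (δ : ℂ) * w‖ ≤ δ := by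
    rw [← dist_eq_norm, H.dist_scale, dist_comm]; exact mul_le_of_le_one_right hδ.le hle
  obtain ⟨b1, b2⟩ := abs_dirCoord_le_norm cfg.km ((δ : ℂ) * toComplex a - (δ : ℂ) * w)
  have e1 : dirCoord cfg.km ((δ : ℂ) * toComplex a - cfg.pmid) =
      dirCoord cfg.km ((δ : ℂ) * toComplex a - (δ : ℂ) * w) + dirCoord cfg.km ((δ : ℂ) * w - cfg.pmid) := by
    rw [← dirCoord_add]; congr 1; ring
  have e2 : dirCoord (cfg.km + 1) ((δ : ℂ) * toComplex a - cfg.pmid) =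
      dirCoord (cfg.km + 1) ((δ : ℂ) * toComplex a - (δ : ℂ) * w) + dirCoord (cfg.km + 1) ((δ : ℂ) * w - cfg.pmid) := by
    rw [← dirCoord_add]; congr 1; ring
  have hℓ := cfg.ℓ_pos; have hδκ := H.δ_le_κ; have hκℓ := cfg.κ_le
  constructor
  · rw [e1]; refine (abs_add_le _ _).trans ?_; linarith
  · rw [e2, ht, add_zero]; exact b2.trans (by linarith)

/-- **`hQa`**: the frozen ends are not on the scaled flat piece (which lies in the free bulk). [folklore] -/
theorem hQa (e : Fin 2) : toComplex (cfg.aEnd δ Λ e) ∉ segment ℝ (cfg.q₁ / δ) (cfg.q₂ / δ) := by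
  intro hmem
  apply (cfg.aEnd_spec δ Λ e).1
  apply H.bulk
  have hmid : (δ : ℂ) * toComplex (cfg.aEnd δ Λ e) ∈ cfg.Mset := H.scale_mem_Mset_of_mem_midSet (Or.inl (Or.inr hmem))
  refine Or.inl (Or.inr (mem_cthickening_of_dist_le _ _ _ _ hmid ?_))
  rw [dist_self]; linarith [cfg.rM_pos]

/-! ### Transport paths and confinement away from `W` -/

/-- Points scaling into the transport paths or the closure of `W` are off the contour and off the
frozen skeleton. [folklore] -/
theorem avoid_of_scale_mem_paths {w : ℂ} (hx : (δ : ℂ) * w ∈ range cfg.Pz ∪ range cfg.Pw ∪ closure cfg.W) :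
    w ∉ cfg.contourL δ Λ μ ∧ w ∉ frozenSkeleton Λ := by
  have hδ := H.δ_pos
  obtain ⟨hm1, hm2, hm3⟩ := cfg.paths_mid _ hx
  constructor
  · intro hC
    rcases H.scale_mem_of_mem_contourL hC with ((h | h) | h) | ⟨e, he⟩
    · exact hm1 h
    · exact hm3 h
    · exact hm2 h
    · have := cfg.paths_end _ hx e
      linarith [H.μ_le_slack]
  · refine not_mem_frozenSkeleton_of_dist fun a ha => ?_
    by_contra hle
    push Not at hle
    apply ha; apply H.bulk
    refine Or.inl (Or.inl (Or.inr (mem_cthickening_of_dist_le _ ((δ : ℂ) * w) _ _ hx ?_)))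
    rw [H.dist_scale, dist_comm]
    calc δ * dist w (toComplex a) ≤ δ * 1 := mul_le_mul_of_nonneg_left hle hδ.le
      _ ≤ cfg.d₀ / 2 := by linarith [H.δ_le_d₀, cfg.d₀_pos]

/-- **The transport path from an exceptional plaquette to `yMinus/δ`** (through `W` and back along
`Pw`), off the contour and the frozen skeleton. [folklore] -/
theorem exists_path_to_yMinus {g : Site 2} (hg : (δ : ℂ) * plaqCentre g ∈ cfg.W) :
    ∃ Pz : Path (plaqCentre g) (cfg.yMinus / δ), ∀ t, Pz t ∉ cfg.contourL δ Λ μ ∧ Pz t ∉ frozenSkeleton Λ := by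
  have hδ' : (δ : ℂ) ≠ 0 := Complex.ofReal_ne_zero.2 H.δ_pos.ne'
  have hJ : JoinedIn cfg.W ((δ : ℂ) * plaqCentre g) cfg.wW := cfg.W_conn.joinedIn _ hg _ cfg.wW_mem
  set γ : Path ((δ : ℂ) * plaqCentre g) cfg.yMinus := hJ.somePath.trans cfg.Pw.symm with hγ
  refine ⟨(scalePath δ γ).cast (by rw [mul_div_cancel_left₀ _ hδ']) rfl, fun t => ?_⟩
  apply H.avoid_of_scale_mem_paths
  rw [Path.cast_coe, scalePath_apply H.δ_pos]
  have ht := mem_range_self (f := γ) t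
  rw [hγ, Path.trans_range] at ht
  rcases ht with ⟨t', ht'⟩ | ⟨t', ht'⟩
  · exact Or.inr (subset_closure (ht' ▸ hJ.somePath_mem t'))
  · rw [← ht']
    exact Or.inl (Or.inr ⟨unitInterval.symm t', rfl⟩)

/-- **The transport path from `yPlus/δ` to the seed plaquette** (back along `Pz`, then straight to
the centre of the seed plaquette inside the seed window), off the contour and the frozen skeleton. [folklore] -/
theorem exists_path_from_yPlus :
    ∃ Pw : Path (cfg.yPlus / δ) (plaqCentre (cfg.f₀ δ)), ∀ t, Pw t ∉ cfg.contourL δ Λ μ ∧ Pw t ∉ frozenSkeleton Λ := by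
  have hδ := H.δ_pos
  have hδ' : (δ : ℂ) ≠ 0 := Complex.ofReal_ne_zero.2 hδ.ne'
  refine ⟨(scalePath δ cfg.Pz.symm).trans (Path.segment (cfg.zStar / δ) (plaqCentre (cfg.f₀ δ))), fun t => ?_⟩
  have ht := mem_range_self (f := (scalePath δ cfg.Pz.symm).trans (Path.segment (cfg.zStar / δ) (plaqCentre (cfg.f₀ δ)))) t
  rw [Path.trans_range, Path.range_segment] at ht
  generalize ((scalePath δ cfg.Pz.symm).trans (Path.segment (cfg.zStar / δ) (plaqCentre (cfg.f₀ δ)))) t = w at ht ⊢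
  rcases ht with ⟨t', ht'⟩ | hw
  · rw [← ht']
    apply H.avoid_of_scale_mem_paths
    rw [scalePath_apply hδ, Path.symm_apply]
    exact Or.inl (Or.inl (mem_range_self _))
  · -- the straight piece inside the seed window
    have hw1 : dist w (cfg.zStar / δ) ≤ 1 :=
      (dist_left_le_of_mem_segment hw).trans (dist_plaqCentre_le_of_mem_plaqClosedSq (mem_plaqClosedSq_plaqOf _))
    constructor
    · intro hC
      have hfar := H.dist_zStar_gt_of_mem_contourL hC
      have : dist ((δ : ℂ) * w) cfg.zStar ≤ δ := by
        have e : cfg.zStar = (δ : ℂ) * (cfg.zStar / δ) := by rw [mul_div_cancel₀ _ hδ']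
        rw [e, H.dist_scale]; exact mul_le_of_le_one_right hδ.le hw1
      have h712 : 712 * cfg.κ ≤ seedClear * cfg.κ := mul_le_mul_of_nonneg_right seedClear_ge cfg.κ_pos.le
      linarith [H.δ_le_κ, cfg.κ_pos]
    · refine not_mem_frozenSkeleton_of_dist fun a ha => ?_
      by_contra hle
      push Not at hle
      apply ha; apply H.bulk
      refine Or.inl (Or.inl (Or.inl (Or.inl (Set.mem_biUnion (Finset.mem_range.2 (Nat.zero_lt_succ _)) ?_))))
      rw [cfg.w_zero]
      have hd : dist (toComplex a) (cfg.zStar / δ) ≤ 2 := by linarith [dist_triangle (toComplex a) w (cfg.zStar / δ), dist_comm w (toComplex a)]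
      have hd' : dist ((δ : ℂ) * toComplex a) cfg.zStar ≤ 2 * δ := by
        have e : cfg.zStar = (δ : ℂ) * (cfg.zStar / δ) := by rw [mul_div_cancel₀ _ hδ']
        rw [e, H.dist_scale]; nlinarith
      refine closedBall_subset_supBox _ _ (mem_closedBall.2 (hd'.trans ?_))
      linarith [H.δ_le_κ, cfg.κ_pos]

/-- **Confinement**: plaquettes whose scaled centre lies in `W` are not in `D`. [cite: ChelkakSmirnov2012Ising, proof of Thm. 6.1 (D^δ lies inside C)] -/
theorem not_mem_Dreg_of_scale_mem_W {g : Site 2} (hg : (δ : ℂ) * plaqCentre g ∈ cfg.W) : g ∉ cfg.Dreg δ Λ μ := by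
  obtain ⟨Pz, hPz⟩ := H.exists_path_to_yMinus hg
  obtain ⟨Pw, hPw⟩ := H.exists_path_from_yPlus
  obtain ⟨hA, hB⟩ := cfg.segSide_scaled H.δ_pos
  exact not_mem_touchReach_of_certificate _ _ _ _ _ _ _ H.holeFree (fun e => (cfg.aEnd_spec δ Λ e).1) hA hB (cfg.pmid_mem_cross δ)
    H.hpieces H.hSk H.hQa H.f₀_not_mem_CsetL Pz hPz Pw hPw

/-- Plaquettes of `D` have a free corner. [folklore] -/
theorem exists_free_corner_of_mem_Dreg {f : Site 2} (hf : f ∈ cfg.Dreg δ Λ μ) : ∃ i : Fin 4, f + cornerOff i ∈ Λ := by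
  rcases mem_touchPlaquettes_of_touchReachable (mem_touchReach_iff.1 hf) with rfl | h
  · have h0 : cfg.f₀ δ ∈ mW (cfg.cH δ 0) (cfg.kH δ) := by
      rw [cH_zero]; simp only [mW, Set.mem_setOf_eq, sub_self, abs_zero]; constructor <;> positivity
    exact exists_corner_of_sideTouch (H.sideTouch_of_mem_mW (Nat.zero_le _) h0 0)
  · exact mem_touchPlaquettes_iff_corner.1 h

/-! ### The one-mesh inequality -/

/-- The end ratio `(L+1)/(R_E+1) ≤ (μ + δ)/dR`. [folklore] -/
theorem endRatio_le : ((Lend δ μ : ℝ) + 1) / ((cfg.RE δ : ℝ) + 1) ≤ (μ + δ) / cfg.dR := by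
  have hδ := H.δ_pos
  have hdR := cfg.dR_pos
  obtain ⟨⟨-, hR⟩, -⟩ := H.RE_bounds
  have hL : (Lend δ μ : ℝ) * δ ≤ μ := H.Lend_mul_le
  rw [div_le_div_iff₀ (by positivity) hdR]
  -- `(L + 1) dR ≤ (μ + δ)(R_E + 1)` since `(L+1) δ ≤ μ + δ` and `dR < δ (R_E + 1)`
  have h1 : ((Lend δ μ : ℝ) + 1) * δ ≤ μ + δ := by linarith
  have h2 : cfg.dR ≤ δ * ((cfg.RE δ : ℝ) + 1) := by
    have := (div_lt_iff₀ hδ).1 hR; linarith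
  calc ((Lend δ μ : ℝ) + 1) * cfg.dR ≤ ((Lend δ μ : ℝ) + 1) * (δ * ((cfg.RE δ : ℝ) + 1)) :=
        mul_le_mul_of_nonneg_left h2 (by positivity)
    _ = (((Lend δ μ : ℝ) + 1) * δ) * ((cfg.RE δ : ℝ) + 1) := by ring
    _ ≤ (μ + δ) * ((cfg.RE δ : ℝ) + 1) := mul_le_mul_of_nonneg_right h1 (by positivity)

/-- **The sign-condition inequality at one mesh.** If, at mesh `δ`, the lattice data satisfy the
scale hypotheses `ScaleHyp cfg δ Λ μ` and `u : plaquettes → ℝ` is a lattice function which is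
sub-harmonic for the boundary-modified Laplacian at the touching plaquettes whose scaled centre
is off `W`, non-negative at the plaquettes with a frozen corner and scaled centre in `G`, bounded
by `M_u N` at the plaquettes with scaled centre in `G`, non-positive where the scaled centre is in
`Kmid μ` and at most `-η₀ N` where it is in `Kflat`, then
`η₀ · κ_mod (c_*/2)^{J+1}/16 ≤ M_u · A · 2 ((μ + δ)/dR)^γ`.
[cite: ChelkakSmirnov2012Ising, proof of Thm. 6.1, (6.8)–(6.10) and Remark 6.3] -/
theorem one_mesh_ineq {u : Site 2 → ℝ} {N Mu η₀ : ℝ} (hN : 0 < N) (hMu : 0 ≤ Mu) (hη₀ : 0 ≤ η₀)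
    (hSub : ∀ f : Site 2, (∃ i : Fin 4, f + cornerOff i ∈ Λ) → (δ : ℂ) * plaqCentre f ∉ cfg.W → 0 ≤ kcModLaplacian Λ (fun _ => 0) u f)
    (hU0 : ∀ f : Site 2, (∃ i : Fin 4, f + cornerOff i ∉ Λ) → (δ : ℂ) * plaqCentre f ∈ G → 0 ≤ u f)
    (hUbd : ∀ f : Site 2, (δ : ℂ) * plaqCentre f ∈ G → u f ≤ Mu * N)
    (hUmid : ∀ f : Site 2, (δ : ℂ) * plaqCentre f ∈ cfg.Kmid μ → u f ≤ 0)
    (hUflat : ∀ f : Site 2, (δ : ℂ) * plaqCentre f ∈ cfg.Kflat → u f ≤ -(η₀ * N)) :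
    η₀ * (modKappa * (maneuverConst / 2) ^ (cfg.J + 1) / 16) ≤ Mu * (endRunConst * (2 * ((μ + δ) / cfg.dR) ^ endDecayExp)) := by
  classical
  have hδ := H.δ_pos
  obtain ⟨-, -, hh1⟩ := H.hH_bounds
  obtain ⟨hk₀, hj₀⟩ := H.seedBond_spec
  -- the lattice inequality
  have key := kc_sign_condition_ineq' H.holeFree (cfg.Dreg δ Λ μ) H.gV u (fun x => (H.gV_bounds x).1) (fun x => (H.gV_bounds x).2)
    (fun f hf => hSub f (H.exists_free_corner_of_mem_Dreg hf) fun hW => H.not_mem_Dreg_of_scale_mem_W hW hf)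
    (H.hu0 hU0) H.Mid H.Flat (fun g hg => H.mid_of_flat hg) (η := η₀ * N) (Mb := Mu * N) (by positivity) (by positivity)
    (fun f _ j _ _ hmid => hUmid _ hmid)
    (fun f _ j _ _ hflat => hUflat _ (H.scale_centre_mem_Kflat_of_flat hflat))
    (fun f hf j hj hn _ => hUbd _ (H.scale_centre_mem_G_of_mem_CsetL (mem_avoid_of_exit H.f₀_not_mem_CsetL hf hj hn)))
    cfg.km (cfg.zm δ) hh1 H.hFlatRun H.hMidBox H.kH_pos (cfg.cH δ) cfg.J H.hHbig H.hHstep H.hHfar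
    H.aS_spec.1 hk₀ hj₀ H.hρR H.hclosed H.hE (by rw [cH_zero]; exact self_mem_touchReach Λ _ _) (by rw [cH_zero]; exact H.f₀_mem_seedBox)
    (Finset.univ : Finset (Fin 2)) H.cE (cfg.aEnd δ Λ) H.kE H.jE (cfg.kDir δ Λ) (fun _ => Lend δ μ) (fun _ => cfg.RE δ)
    (fun e _ => H.haE e) (fun e _ => H.hLE) (fun e _ => H.hdeadE e) (fun e _ => H.hrunE e) (fun e _ => H.hconeE e) H.hcarry
  -- the scale-free form
  simp only [Finset.sum_const, Finset.card_univ, Fintype.card_fin, nsmul_eq_mul, Nat.cast_ofNat] at key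
  have hratio : (((Lend δ μ : ℝ) + 1) / ((cfg.RE δ : ℝ) + 1)) ^ endDecayExp ≤ ((μ + δ) / cfg.dR) ^ endDecayExp :=
    Real.rpow_le_rpow (by positivity) H.endRatio_le endDecayExp_pos.le
  have hA := endRunConst_pos
  have hX : 0 ≤ modKappa * (maneuverConst / 2) ^ (cfg.J + 1) / 16 := by
    have := modKappa_pos; have := maneuverConst_pos; positivity
  -- divide by `N`
  have key' : N * (η₀ * (modKappa * (maneuverConst / 2) ^ (cfg.J + 1) / 16)) ≤
      N * (Mu * (endRunConst * (2 * ((μ + δ) / cfg.dR) ^ endDecayExp))) := by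
    calc N * (η₀ * (modKappa * (maneuverConst / 2) ^ (cfg.J + 1) / 16))
        = η₀ * N * (modKappa * (maneuverConst / 2) ^ (cfg.J + 1) / 16) := by ring
      _ ≤ Mu * N * (endRunConst * (2 * (((Lend δ μ : ℝ) + 1) / ((cfg.RE δ : ℝ) + 1)) ^ endDecayExp)) := key
      _ ≤ Mu * N * (endRunConst * (2 * ((μ + δ) / cfg.dR) ^ endDecayExp)) := by
        apply mul_le_mul_of_nonneg_left _ (by positivity)
        apply mul_le_mul_of_nonneg_left _ hA.le
        linarith
      _ = N * (Mu * (endRunConst * (2 * ((μ + δ) / cfg.dR) ^ endDecayExp))) := by ring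
  exact le_of_mul_le_mul_left key' hN

end ScaleHyp

end KCSignConfig

end Literature.Probability.LatticeModels
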